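import Mathlib
import HarnessLib.Audit
import Summits.PneNP.PneNP.Theorems.PstarCrossCaseU2Carrier
import Summits.PneNP.PneNP.Theorems.PstarCrossBudgetCarriers
import Summits.PneNP.PneNP.Theorems.PstarCrossNodes
import Summits.PneNP.PneNP.Theorems.PstarCoincidenceMatching
import Summits.PneNP.PneNP.Theorems.PstarRankRigidity

/-!
# The blind free CROSS gate: node N4 (`CrossU2`) is CLOSED — rank six kills a third edge of `D e₀`, and the carrier of a product row breaks the budget (O2 / E1; prover-1 g23)

FRONTIER range-avoidance ladder, rung F-N3 (`stmt-PneNP-19007`), cell `pnp-ideate`; restricted-model proof complexity — nothing here bears on `P` versus `NP`.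

Node N4 of `PstarCrossNodes` (one real chord `e₀` besides the two gate chords, read independently by both constraints, corner-forced).  With
`u₀ = γ₀ + Q_{D e₀}`, both state-free parts `q_{(1,0)} + κ₂`, `q_{(0,1)} + κ₁` vanish on `Z(u₀)` (`PstarCrossCaseU2`), so each is CLEAN (`0`, `u₀`) or a
NON-DEGENERATE product row (`PstarCrossCaseU2Touch.clean_or_nondeg`).  Both clean: `PstarCrossCaseU2Clean.false_of_clean`.  Otherwise:

* every private tree edge lies in `D e₀` (a row reads a private edge only at the AND variables of `D e₀`, `PstarCrossCaseU2Touch.untouched_of_not_mem_D`;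
  an unread private edge contradicts TOUCH, `PstarCrossBudget.cross_touch`);
* the budget `#(J₀ ∖ N) + 3 ≤ #N + 2·#Pv` (`PstarCrossBudget.cross_budget`, `#N = 3`) gives `#J₀ ≤ 5` outright unless there are two private tree
  edges `π₁ ≠ π₂` — both in `D e₀`;
* `inducedMatching_three`, **`false_of_third_edge`** — a third edge of `D e₀` makes `{π₁, π₂, j}` an induced matching of the AND-graph of `D e₀`, so
  `rank Q_{D e₀} ≥ 6` (`PstarCoincidenceMatching.finrank_ker_add_le_of_inducedMatching`) and a quadratic vanishing on `Z(u₀)` is `0` or `u₀`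
  (`PstarRankRigidity.eq_zero_or_eq_of_rank_six`) — not a non-degenerate product (`PstarCrossProductAlgebra.exists_eq_one_one`,
  `PstarForcing.not_rank_four_of_mul`); hence `D e₀ = {π₁, π₂}`;
* `untouched_or_carrier` — then each constraint leaves `π₁` untouched or carries a monomial with one AND variable on `π₁` and one on `π₂`
  (`PstarCrossCaseU2Carrier.touch_or_carrier`); by TOUCH some constraint has such a CARRIER `o`, and the budget with `O = {o}`
  (`PstarCrossBudgetCarriers.cross_budget_carriers`) has no private edge left: `#(J₀ ∖ N) + 3 ≤ 3 + 1`, contradicting `#(J₀ ∖ N) ≥ #(D e₀) ≥ 2`.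
Main result: **`crossU2 : CrossU2`**.  With `PstarCrossNodes.cross1BlindOr_of_nodes` the E1 residue is now `N1 ∧ N2 ∧ N3`.
-/

set_option linter.dupNamespace false -- `Summit.PneNP.PneNP.…`: summit = sub-problem name (D-0017 single-conjunct layout)

open Finset Module Literature.Computability.Complexity
open Summit.PneNP.PneNP.Theorems.PstarTyped (Typed)
open Summit.PneNP.PneNP.Theorems.PstarSALevel (varSet BoundaryExpanding SimpleOverlap)
open Summit.PneNP.PneNP.Theorems.PstarCentreFree (vars_mem_varSet)
open Summit.PneNP.PneNP.Theorems.PstarCubeIdeals (IsAffineFn IsQuadFn)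
open Summit.PneNP.PneNP.Theorems.PstarQuadRank (rad)
open Summit.PneNP.PneNP.Theorems.PstarProductRank (qform polar cover mem_cover IsInducedMatching)
open Summit.PneNP.PneNP.Theorems.PstarPathRank (AndAdj polar_basis and_ne andPair_ne)
open Summit.PneNP.PneNP.Theorems.PstarReadSumset (V2)
open Summit.PneNP.PneNP.Theorems.PstarRankRigidityTwo (affine_mul_polar symForm linPart)
open Summit.PneNP.PneNP.Theorems.PstarRankRigidity (eq_zero_or_eq_of_rank_six)
open Summit.PneNP.PneNP.Theorems.PstarForcing (not_rank_four_of_mul)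
open Summit.PneNP.PneNP.Theorems.PstarCoincidenceMatching (finrank_ker_add_le_of_inducedMatching)
open Summit.PneNP.PneNP.Theorems.PstarChordSystem (ChordSystem)
open Summit.PneNP.PneNP.Theorems.PstarChordBridgeTools
open Summit.PneNP.PneNP.Theorems.PstarChordBridge
open Summit.PneNP.PneNP.Theorems.PstarChordBridgeForcing (freeMon gam sys_u_eq rank_four_of_wf)
open Summit.PneNP.PneNP.Theorems.PstarChordBridgeFundamental (two_le_card_of_even)
open Summit.PneNP.PneNP.Theorems.PstarChordBridgeBasis (qDir polarDir)
open Summit.PneNP.PneNP.Theorems.PstarGateCasePUnitsTouch (not_mem_C_of_qDir polarDir_single)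
open Summit.PneNP.PneNP.Theorems.PstarCrossData (CrossData)
open Summit.PneNP.PneNP.Theorems.PstarCrossSystem
open Summit.PneNP.PneNP.Theorems.PstarCrossCorner (PrivEdge)
open Summit.PneNP.PneNP.Theorems.PstarCrossBudget (cross_budget cross_touch)
open Summit.PneNP.PneNP.Theorems.PstarCrossBudgetCarriers (cross_budget_carriers)
open Summit.PneNP.PneNP.Theorems.PstarCrossNodes (CrossU2)
open Summit.PneNP.PneNP.Theorems.PstarCrossCaseU2 (u_add qDir_of_killable isQuadFn_qDir)
open Summit.PneNP.PneNP.Theorems.PstarCrossCaseU2Clean (untouched_of_clean false_of_clean)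
open Summit.PneNP.PneNP.Theorems.PstarCrossProductAlgebra (exists_eq_one_one)
open Summit.PneNP.PneNP.Theorems.PstarCrossCaseU2Touch (card_J₀_le clean_or_nondeg ne_of_privEdge untouched_of_not_mem_D)
open Summit.PneNP.PneNP.Theorems.PstarCrossCaseU2Carrier (touch_or_carrier)

namespace Summit.PneNP.PneNP.Theorems.PstarCrossCaseU2Final

variable {n m : ℕ}

section

variable (I : LocalMap 4 n m) {r : ℕ} {B : BridgeData n m} {e_p e_q g₀ : Fin m}

/-! ## Rank six: no third edge in `D e₀` -/

/-- The four AND-variable inequalities between a private tree edge and another output of the core. -/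
theorem four_ne {π : Fin m} (hπ : PrivEdge I B π) {k : Fin m} (hk : k ∈ B.J₀) (hkπ : k ≠ π) :
    I.vars π 2 ≠ I.vars k 2 ∧ I.vars π 2 ≠ I.vars k 3 ∧ I.vars π 3 ≠ I.vars k 2 ∧ I.vars π 3 ≠ I.vars k 3 :=
  ⟨(ne_of_privEdge I hπ (Or.inl rfl) hk hkπ 2).symm, (ne_of_privEdge I hπ (Or.inl rfl) hk hkπ 3).symm,
    (ne_of_privEdge I hπ (Or.inr rfl) hk hkπ 2).symm, (ne_of_privEdge I hπ (Or.inr rfl) hk hkπ 3).symm⟩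

/-- **Two private tree edges and any third edge of `D e₀` form an induced matching of the AND-graph of `D e₀`.** -/
theorem inducedMatching_three (hI : I.IsPure xorAndPred) (hS : SimpleOverlap I) (hD : CrossData I r B e_p e_q g₀) {e₀ : Fin m} (he₀ : e₀ ∈ B.N)
    {π₁ π₂ j : Fin m} (hπ₁ : PrivEdge I B π₁) (hπ₂ : PrivEdge I B π₂) (h12 : π₁ ≠ π₂) (hπ₁D : π₁ ∈ B.D e₀) (hπ₂D : π₂ ∈ B.D e₀)
    (hj : j ∈ B.D e₀) (hj₁ : j ≠ π₁) (hj₂ : j ≠ π₂) :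
    IsInducedMatching (B.D e₀) {π₁, π₂, j} (fun k => I.vars k 2) (fun k => I.vars k 3) := by
  classical
  have hDJ : B.D e₀ ⊆ B.J₀ := (hD.wf.hD e₀ he₀).trans sdiff_subset
  have hjJ : j ∈ B.J₀ := hDJ hj
  have hπ₁J : π₁ ∈ B.J₀ := hDJ hπ₁D
  have hπ₂J : π₂ ∈ B.J₀ := hDJ hπ₂D
  refine ⟨?_, fun k _ => and_ne I hI k, ?_, ?_⟩
  · exact insert_subset hπ₁D (insert_subset hπ₂D (singleton_subset_iff.2 hj))
  · intro k hk k' hk' hne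
    simp only [mem_insert, mem_singleton] at hk hk'
    have sym : ∀ {π k : Fin m}, PrivEdge I B π → k ∈ B.J₀ → k ≠ π →
        I.vars k 2 ≠ I.vars π 2 ∧ I.vars k 2 ≠ I.vars π 3 ∧ I.vars k 3 ≠ I.vars π 2 ∧ I.vars k 3 ≠ I.vars π 3 :=
      fun hπ hk hkπ => by
        obtain ⟨a, b, c, d⟩ := four_ne I hπ hk hkπ
        exact ⟨a.symm, c.symm, b.symm, d.symm⟩
    rcases hk with rfl | rfl | rfl
    · rcases hk' with rfl | rfl | rfl
      · exact absurd rfl hne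
      · exact four_ne I hπ₁ hπ₂J hne.symm
      · exact four_ne I hπ₁ hjJ hne.symm
    · rcases hk' with rfl | rfl | rfl
      · exact four_ne I hπ₂ hπ₁J hne.symm
      · exact absurd rfl hne
      · exact four_ne I hπ₂ hjJ hne.symm
    · rcases hk' with rfl | rfl | rfl
      · exact sym hπ₁ hjJ hj₁
      · exact sym hπ₂ hjJ hj₂
      · exact absurd rfl hne
  · intro j' hj' h2 h3
    have hj'J : j' ∈ B.J₀ := hDJ hj'
    simp only [mem_insert, mem_singleton]
    by_cases e1 : j' = π₁
    · exact Or.inl e1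
    by_cases e2 : j' = π₂
    · exact Or.inr (Or.inl e2)
    by_cases e3 : j' = j
    · exact Or.inr (Or.inr e3)
    exfalso
    -- both AND variables of `j'` lie on `j`
    have onj : ∀ s : Fin 4, (s = 2 ∨ s = 3) → I.vars j' s ∈ cover {π₁, π₂, j} (fun k => I.vars k 2) (fun k => I.vars k 3) →
        I.vars j' s = I.vars j 2 ∨ I.vars j' s = I.vars j 3 := by
      intro s _ hc
      obtain ⟨k, hk, hks⟩ := mem_cover.1 hc
      simp only [mem_insert, mem_singleton] at hk
      rcases hk with rfl | rfl | rfl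
      · exfalso
        obtain ⟨a, b, c, d⟩ := four_ne I hπ₁ hj'J e1
        rcases hks with h | h
        · exact (by fin_cases s <;> simp_all : False)
        · exact (by fin_cases s <;> simp_all : False)
      · exfalso
        obtain ⟨a, b, c, d⟩ := four_ne I hπ₂ hj'J e2
        rcases hks with h | h
        · exact (by fin_cases s <;> simp_all : False)
        · exact (by fin_cases s <;> simp_all : False)
      · exact hks
    have h2' := onj 2 (Or.inl rfl) h2
    have h3' := onj 3 (Or.inr rfl) h3
    have hne' := and_ne I hI j'
    refine andPair_ne I hI hS e3 ?_
    rcases h2' with a | a <;> rcases h3' with b | b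
    · exact absurd (a.trans b.symm) hne'
    · exact Or.inl ⟨a, b⟩
    · exact Or.inr ⟨a, b⟩
    · exact absurd (a.trans b.symm) hne'

/-- **A third edge of `D e₀` next to two private ones kills every non-degenerate product row**: the induced matching gives `rank Q_{D e₀} ≥ 6`, so a
quadratic vanishing on `Z(u₀)` is `0` or `u₀`; a non-degenerate product is neither (it takes the value `1`; `u₀` has rank `≥ 4`). -/
theorem false_of_third_edge (hI : I.IsPure xorAndPred) (hS : SimpleOverlap I) (hB : BoundaryExpanding r I) (hD : CrossData I r B e_p e_q g₀)
    {e₀ : Fin m} (he₀ : e₀ ∈ B.N) {μ₁ μ₂ : (Fin n → ZMod 2) → ZMod 2} (h₁ : IsAffineFn μ₁) (h₂ : IsAffineFn μ₂)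
    (hn₁ : ∃ z, μ₁ z ≠ μ₁ 0) (hn₂ : ∃ z, μ₂ z ≠ μ₂ 0) (hn : ∃ z, μ₁ z + μ₁ 0 ≠ μ₂ z + μ₂ 0)
    (hZ : ∀ x, (sys I B).u e₀ x = 0 → μ₁ x * μ₂ x = 0)
    {π₁ π₂ j : Fin m} (hπ₁ : PrivEdge I B π₁) (hπ₂ : PrivEdge I B π₂) (h12 : π₁ ≠ π₂) (hπ₁D : π₁ ∈ B.D e₀) (hπ₂D : π₂ ∈ B.D e₀)
    (hj : j ∈ B.D e₀) (hj₁ : j ≠ π₁) (hj₂ : j ≠ π₂) : False := by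
  classical
  have hM := inducedMatching_three I hI hS hD he₀ hπ₁ hπ₂ h12 hπ₁D hπ₂D hj hj₁ hj₂
  have hcard : ({π₁, π₂, j} : Finset (Fin m)).card = 3 := by
    rw [card_insert_of_notMem, card_insert_of_notMem, card_singleton]
    · rw [mem_singleton]; exact fun h => hj₂ h.symm
    · rw [mem_insert, mem_singleton, not_or]; exact ⟨h12, fun h => hj₁ h.symm⟩
  have h6 := finrank_ker_add_le_of_inducedMatching (K := ZMod 2) hM
  rw [hcard] at h6
  have hrank6 : finrank (ZMod 2) (rad (polar (B.D e₀) (fun k => I.vars k 2) (fun k => I.vars k 3))) + 6 ≤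
      finrank (ZMod 2) (Fin n → ZMod 2) := by
    unfold PstarQuadRank.rad; omega
  have hu := u_add I B e₀
  have hP : IsQuadFn fun x => μ₁ x * μ₂ x := ⟨symForm (linPart h₁) (linPart h₂), affine_mul_polar h₁ h₂⟩
  rcases eq_zero_or_eq_of_rank_six hu hrank6 hP hZ with h0 | hq
  · obtain ⟨y, hy₁, hy₂⟩ := exists_eq_one_one h₁ h₂ hn₁ hn₂ hn 1 1
    have h := h0 y
    simp only [hy₁, hy₂, mul_one] at h
    exact one_ne_zero h
  · have hrank4 := rank_four_of_wf I hI hS hB hD.wf (card_J₀_le I hD) he₀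
    exact not_rank_four_of_mul hu h₁ h₂ (κ := 0) (fun x => by rw [add_zero]; exact (hq x).symm) hrank4

/-! ## Per-constraint packages -/

/-- A row (clean or non-degenerate product) of the constraint `(C, G, T)` behind `q_{mv}` does not read a private tree edge outside `D e₀`. -/
theorem untouched_of_row (hI : I.IsPure xorAndPred) (hS : SimpleOverlap I) (hB : BoundaryExpanding r I) (hD : CrossData I r B e_p e_q g₀)
    {e₀ : Fin m} (he₀ : e₀ ∈ B.N) {mv : V2} {C : Finset (Fin n)} {G T : Finset (Fin m)} (hTJ : T ⊆ B.J₀ \ B.N) (hGJ : Disjoint G B.J₀)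
    (hGfree : ∀ g ∈ G, ¬ (I.vars g 2 ∈ privs I B.N ∨ I.vars g 3 ∈ privs I B.N))
    (hlin : ∀ (π : Fin m) (s : Fin 4), π ∈ B.J₀ \ B.N → 2 ≤ s.val → qDir I B mv (Pi.single (I.vars π s) 1) = qDir I B mv 0 → I.vars π s ∉ C)
    (hpol : ∀ c d : Fin n, polarDir I B mv (Pi.single c 1) (Pi.single d 1) =
      ((polar T (fun j => I.vars j 2) (fun j => I.vars j 3) + polar (freeMon I B.N G) (fun j => I.vars j 2) (fun j => I.vars j 3) :
        LinearMap.BilinForm (ZMod 2) (Fin n → ZMod 2)) (Pi.single c 1)) (Pi.single d 1))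
    {κ : ZMod 2}
    (hrowc : ((∀ x, qDir I B mv x + κ = 0) ∨ (∀ x, qDir I B mv x + κ = (sys I B).u e₀ x)) ∨
      ∃ μ₁ μ₂ : (Fin n → ZMod 2) → ZMod 2, IsAffineFn μ₁ ∧ IsAffineFn μ₂ ∧
        (∃ z, μ₁ z ≠ μ₁ 0) ∧ (∃ z, μ₂ z ≠ μ₂ 0) ∧ (∃ z, μ₁ z + μ₁ 0 ≠ μ₂ z + μ₂ 0) ∧
        ((∀ x, qDir I B mv x + κ = μ₁ x * μ₂ x) ∨ (∀ x, (sys I B).u e₀ x + (qDir I B mv x + κ) = μ₁ x * μ₂ x)))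
    (hZq : ∀ x, (sys I B).u e₀ x = 0 → qDir I B mv x + κ = 0)
    {π : Fin m} (hπ : PrivEdge I B π) (hπD : π ∉ B.D e₀) :
    (I.vars π 2 ∉ C ∧ I.vars π 3 ∉ C) ∧ ∀ g ∈ G, I.vars g 2 ≠ I.vars π 2 ∧ I.vars g 3 ≠ I.vars π 2 ∧ I.vars g 2 ≠ I.vars π 3 ∧ I.vars g 3 ≠ I.vars π 3 := by
  rcases hrowc with hclean | ⟨μ₁, μ₂, h₁, h₂, hn₁, hn₂, hn, hrow⟩
  · exact untouched_of_clean I hI hS hD he₀ hTJ hGJ hGfree hlin hpol hclean hπ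
  · have hZ : ∀ x, (sys I B).u e₀ x = 0 → μ₁ x * μ₂ x = 0 := fun x hx => by
      rcases hrow with h | h
      · rw [← h x, hZq x hx]
      · rw [← h x, hZq x hx, hx, add_zero]
    exact untouched_of_not_mem_D I hI hS hB hD he₀ hTJ hGJ hGfree hlin hpol h₁ h₂ hn₁ hn₂ hn hrow hZ hπ hπD

/-- A row of the constraint `(C, G, T)` behind `q_{mv}`, when `D e₀ ⊆ {π₁, π₂}` (`π₁` private, `π₂ ∈ D e₀`): `π₁` is untouched, or `G` has a carrier
with one AND variable on `π₁` and one on `π₂`. -/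
theorem untouched_or_carrier (hI : I.IsPure xorAndPred) (hS : SimpleOverlap I) (hB : BoundaryExpanding r I) (hD : CrossData I r B e_p e_q g₀)
    {e₀ : Fin m} (he₀ : e₀ ∈ B.N) {mv : V2} {C : Finset (Fin n)} {G T : Finset (Fin m)} (hTJ : T ⊆ B.J₀ \ B.N) (hGJ : Disjoint G B.J₀)
    (hGfree : ∀ g ∈ G, ¬ (I.vars g 2 ∈ privs I B.N ∨ I.vars g 3 ∈ privs I B.N))
    (hlin : ∀ (π : Fin m) (s : Fin 4), π ∈ B.J₀ \ B.N → 2 ≤ s.val → qDir I B mv (Pi.single (I.vars π s) 1) = qDir I B mv 0 → I.vars π s ∉ C)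
    (hpol : ∀ c d : Fin n, polarDir I B mv (Pi.single c 1) (Pi.single d 1) =
      ((polar T (fun j => I.vars j 2) (fun j => I.vars j 3) + polar (freeMon I B.N G) (fun j => I.vars j 2) (fun j => I.vars j 3) :
        LinearMap.BilinForm (ZMod 2) (Fin n → ZMod 2)) (Pi.single c 1)) (Pi.single d 1))
    {κ : ZMod 2}
    (hrowc : ((∀ x, qDir I B mv x + κ = 0) ∨ (∀ x, qDir I B mv x + κ = (sys I B).u e₀ x)) ∨
      ∃ μ₁ μ₂ : (Fin n → ZMod 2) → ZMod 2, IsAffineFn μ₁ ∧ IsAffineFn μ₂ ∧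
        (∃ z, μ₁ z ≠ μ₁ 0) ∧ (∃ z, μ₂ z ≠ μ₂ 0) ∧ (∃ z, μ₁ z + μ₁ 0 ≠ μ₂ z + μ₂ 0) ∧
        ((∀ x, qDir I B mv x + κ = μ₁ x * μ₂ x) ∨ (∀ x, (sys I B).u e₀ x + (qDir I B mv x + κ) = μ₁ x * μ₂ x)))
    (hZq : ∀ x, (sys I B).u e₀ x = 0 → qDir I B mv x + κ = 0)
    {π₁ π₂ : Fin m} (hπ₁ : PrivEdge I B π₁) (hne : π₁ ≠ π₂) (hπ₂D : π₂ ∈ B.D e₀) (hD2 : ∀ j ∈ B.D e₀, j = π₁ ∨ j = π₂) :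
    ((I.vars π₁ 2 ∉ C ∧ I.vars π₁ 3 ∉ C) ∧
      ∀ g ∈ G, I.vars g 2 ≠ I.vars π₁ 2 ∧ I.vars g 3 ≠ I.vars π₁ 2 ∧ I.vars g 2 ≠ I.vars π₁ 3 ∧ I.vars g 3 ≠ I.vars π₁ 3) ∨
    ∃ o ∈ freeMon I B.N G, ∃ s s₂ : Fin 4, (s = 2 ∨ s = 3) ∧ (s₂ = 2 ∨ s₂ = 3) ∧
      ((I.vars o 2 = I.vars π₂ s₂ ∧ I.vars o 3 = I.vars π₁ s) ∨ (I.vars o 2 = I.vars π₁ s ∧ I.vars o 3 = I.vars π₂ s₂)) := by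
  rcases hrowc with hclean | ⟨μ₁, μ₂, h₁, h₂, hn₁, hn₂, hn, hrow⟩
  · exact Or.inl (untouched_of_clean I hI hS hD he₀ hTJ hGJ hGfree hlin hpol hclean hπ₁)
  · have hZ : ∀ x, (sys I B).u e₀ x = 0 → μ₁ x * μ₂ x = 0 := fun x hx => by
      rcases hrow with h | h
      · rw [← h x, hZq x hx]
      · rw [← h x, hZq x hx, hx, add_zero]
    exact touch_or_carrier I hI hS hB hD he₀ hTJ hGJ hGfree hlin hpol h₁ h₂ hn₁ hn₂ hn hrow hZ hπ₁ hne hπ₂D hD2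

end

/-! ## Node N4 -/

/-- **Node N4 of the blind free cross gate is closed: `CrossU2`.**  See the module docstring. -/
theorem crossU2 : CrossU2 := by
  classical
  intro n m r I hI hT hS hB B e_p e_q g₀ hD e₀ hE h1 h2 h3 hcorner
  have hW := hD.wf
  have he₀' : e₀ ∈ (B.N.erase e_q).erase e_p := by rw [hE]; exact mem_singleton_self _
  have he₀ : e₀ ∈ B.N := mem_of_mem_erase (mem_of_mem_erase he₀')
  -- `#N = 3`, `#(J₀ ∖ N) ≥ #(D e₀) ≥ 2`
  have hN : B.N = insert e_q (insert e_p {e₀}) := by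
    rw [← insert_erase hD.mem_q, ← insert_erase (mem_erase.2 ⟨hD.ne, hD.mem_p⟩ : e_p ∈ B.N.erase e_q), hE]
  have hN3 : B.N.card = 3 := by
    rw [hN, card_insert_of_notMem, card_insert_of_notMem, card_singleton]
    · exact fun h => (ne_of_mem_erase he₀').symm (mem_singleton.1 h)
    · rw [mem_insert, mem_singleton]; push Not
      exact ⟨hD.ne.symm, fun h => (ne_of_mem_erase (mem_of_mem_erase he₀')).symm h⟩
  have hDe : 2 ≤ (B.D e₀).card :=
    two_le_card_of_even I hI hS (fun h => (mem_sdiff.1 (hW.hD e₀ he₀ h)).2 he₀) (hW.hDeven e₀ he₀)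
  have hDT : (B.D e₀).card ≤ (B.J₀ \ B.N).card := card_le_card (hW.hD e₀ he₀)
  have hJcard : (B.J₀ \ B.N).card + B.N.card = B.J₀.card := card_sdiff_add_card_eq_card hW.hN
  -- both state-free parts vanish on `Z(u₀)`
  set κ₂ : ZMod 2 := (((sys I B).vsys e_p e_q).ρ e₀ 0 + ((sys I B).vsys e_p e_q).ρ' e₀ 0).2 with hκ₂
  set κ₁ : ZMod 2 := 1 + (((sys I B).vsys e_p e_q).ρ e₀ 0 + ((sys I B).vsys e_p e_q).ρ' e₀ 0).1 with hκ₁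
  have hZ10 : ∀ x, (sys I B).u e₀ x = 0 → qDir I B (1, 0) x + κ₂ = 0 := fun x hx => by
    rw [(qDir_of_killable I hI hT hD hE h1 h2 h3 hcorner hx).1]; exact CharTwo.add_self_eq_zero _
  have hZ01 : ∀ x, (sys I B).u e₀ x = 0 → qDir I B (0, 1) x + κ₁ = 0 := fun x hx => by
    rw [(qDir_of_killable I hI hT hD hE h1 h2 h3 hcorner hx).2]; exact CharTwo.add_self_eq_zero _
  have hr10 := clean_or_nondeg I hI hS hB hD he₀ (isQuadFn_qDir I B (1, 0) κ₂) hZ10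
  have hr01 := clean_or_nondeg I hI hS hB hD he₀ (isQuadFn_qDir I B (0, 1) κ₁) hZ01
  -- both rows clean: done (`false_of_clean`)
  by_cases hboth : ((∀ x, qDir I B (1, 0) x + κ₂ = 0) ∨ (∀ x, qDir I B (1, 0) x + κ₂ = (sys I B).u e₀ x)) ∧
      ((∀ x, qDir I B (0, 1) x + κ₁ = 0) ∨ (∀ x, qDir I B (0, 1) x + κ₁ = (sys I B).u e₀ x))
  · exact (false_of_clean I hI hT hS hB hD hE hboth.1 hboth.2).elim
  -- otherwise some row is a non-degenerate product vanishing on `Z(u₀)`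
  obtain ⟨μ₁, μ₂, h₁, h₂, hn₁, hn₂, hn, hZ⟩ : ∃ μ₁ μ₂ : (Fin n → ZMod 2) → ZMod 2, IsAffineFn μ₁ ∧ IsAffineFn μ₂ ∧
      (∃ z, μ₁ z ≠ μ₁ 0) ∧ (∃ z, μ₂ z ≠ μ₂ 0) ∧ (∃ z, μ₁ z + μ₁ 0 ≠ μ₂ z + μ₂ 0) ∧ ∀ x, (sys I B).u e₀ x = 0 → μ₁ x * μ₂ x = 0 := by
    rcases hr10 with hc10 | ⟨μ₁, μ₂, h₁, h₂, hn₁, hn₂, hn, hrow⟩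
    · rcases hr01 with hc01 | ⟨μ₁, μ₂, h₁, h₂, hn₁, hn₂, hn, hrow⟩
      · exact absurd ⟨hc10, hc01⟩ hboth
      · refine ⟨μ₁, μ₂, h₁, h₂, hn₁, hn₂, hn, fun x hx => ?_⟩
        rcases hrow with h | h
        · rw [← h x, hZ01 x hx]
        · rw [← h x, hZ01 x hx, hx, add_zero]
    · refine ⟨μ₁, μ₂, h₁, h₂, hn₁, hn₂, hn, fun x hx => ?_⟩
      rcases hrow with h | h
      · rw [← h x, hZ10 x hx]
      · rw [← h x, hZ10 x hx, hx, add_zero]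
  -- the constraint data
  have hGfree : ∀ G : Finset (Fin m), (∀ v ∈ privs I B.N, ∀ g ∈ G, I.vars g 2 ≠ v ∧ I.vars g 3 ≠ v) →
      ∀ g ∈ G, ¬ (I.vars g 2 ∈ privs I B.N ∨ I.vars g 3 ∈ privs I B.N) := by
    intro G h g hg hor
    rcases hor with h2 | h3
    · exact (h _ h2 g hg).1 rfl
    · exact (h _ h3 g hg).2 rfl
  have hd₁ : Disjoint B.G₁ B.J₀ := Finset.disjoint_of_subset_left (subset_insert g₀ B.G₁) hD.disj₁
  have hGf₁ := hGfree B.G₁ fun v hv => (hD.hun v hv).1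
  have hGf₂ := hGfree B.G₂ fun v hv => (hD.hun v hv).2
  have hlin₁ : ∀ (π : Fin m) (s : Fin 4), π ∈ B.J₀ \ B.N → 2 ≤ s.val →
      qDir I B (0, 1) (Pi.single (I.vars π s) 1) = qDir I B (0, 1) 0 → I.vars π s ∉ B.C₁ :=
    fun π s hπ hs h => (not_mem_C_of_qDir I hI hT hW hπ hs).1 h
  have hlin₂ : ∀ (π : Fin m) (s : Fin 4), π ∈ B.J₀ \ B.N → 2 ≤ s.val →
      qDir I B (1, 0) (Pi.single (I.vars π s) 1) = qDir I B (1, 0) 0 → I.vars π s ∉ B.C₂ :=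
    fun π s hπ hs h => (not_mem_C_of_qDir I hI hT hW hπ hs).2 h
  have hpol₁ : ∀ c d : Fin n, polarDir I B (0, 1) (Pi.single c 1) (Pi.single d 1) =
      ((polar B.T₁ (fun j => I.vars j 2) (fun j => I.vars j 3) + polar (freeMon I B.N B.G₁) (fun j => I.vars j 2) (fun j => I.vars j 3) :
        LinearMap.BilinForm (ZMod 2) (Fin n → ZMod 2)) (Pi.single c 1)) (Pi.single d 1) := fun c d => by
    rw [polarDir_single]; simp
  have hpol₂ : ∀ c d : Fin n, polarDir I B (1, 0) (Pi.single c 1) (Pi.single d 1) =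
      ((polar B.T₂ (fun j => I.vars j 2) (fun j => I.vars j 3) + polar (freeMon I B.N B.G₂) (fun j => I.vars j 2) (fun j => I.vars j 3) :
        LinearMap.BilinForm (ZMod 2) (Fin n → ZMod 2)) (Pi.single c 1)) (Pi.single d 1) := fun c d => by
    rw [polarDir_single]; simp
  -- every private tree edge lies in `D e₀`
  have hmemD : ∀ π, PrivEdge I B π → π ∈ B.D e₀ := fun π hπ => by
    by_contra hπD
    obtain ⟨hC₁, hG₁⟩ := untouched_of_row I hI hS hB hD he₀ (mv := (0, 1)) hW.hT₁ hd₁ hGf₁ hlin₁ hpol₁ hr01 hZ01 hπ hπD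
    obtain ⟨hC₂, hG₂⟩ := untouched_of_row I hI hS hB hD he₀ (mv := (1, 0)) hW.hT₂ hD.disj₂ hGf₂ hlin₂ hpol₂ hr10 hZ10 hπ hπD
    exact cross_touch I hI hD hπ.1 hπ.2 hC₁ hC₂ hG₁ hG₂
  -- the budget without carriers: done unless there are two private edges
  obtain ⟨Pv, hPvT, hpriv, hcount⟩ := cross_budget I hB hD
  have hPvE : ∀ π ∈ Pv, PrivEdge I B π := fun π hπ => ⟨hPvT hπ, fun j hj hne => hpriv π hπ j (mem_insert_of_mem hj) hne⟩
  by_cases hPv1 : Pv.card ≤ 1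
  · omega
  obtain ⟨π₁, hπ₁P, π₂, hπ₂P, h12⟩ := (one_lt_card (s := Pv)).1 (by omega)
  exfalso
  have hπ₁ := hPvE π₁ hπ₁P
  have hπ₂ := hPvE π₂ hπ₂P
  have hπ₁D := hmemD π₁ hπ₁
  have hπ₂D := hmemD π₂ hπ₂
  have hπ₁J : π₁ ∈ B.J₀ := (mem_sdiff.1 hπ₁.1).1
  have hπ₂J : π₂ ∈ B.J₀ := (mem_sdiff.1 hπ₂.1).1
  -- no third edge: `D e₀ = {π₁, π₂}`
  have hD2 : ∀ j ∈ B.D e₀, j = π₁ ∨ j = π₂ := fun j hj => by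
    by_contra hno
    push Not at hno
    exact false_of_third_edge I hI hS hB hD he₀ h₁ h₂ hn₁ hn₂ hn hZ hπ₁ hπ₂ h12 hπ₁D hπ₂D hj hno.1 hno.2
  -- a carrier
  obtain ⟨o, hoG, s, s₂, hs, hs₂, hoor⟩ : ∃ o ∈ B.G₁ ∪ B.G₂, ∃ s s₂ : Fin 4, (s = 2 ∨ s = 3) ∧ (s₂ = 2 ∨ s₂ = 3) ∧
      ((I.vars o 2 = I.vars π₂ s₂ ∧ I.vars o 3 = I.vars π₁ s) ∨ (I.vars o 2 = I.vars π₁ s ∧ I.vars o 3 = I.vars π₂ s₂)) := by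
    rcases untouched_or_carrier I hI hS hB hD he₀ (mv := (0, 1)) hW.hT₁ hd₁ hGf₁ hlin₁ hpol₁ hr01 hZ01 hπ₁ h12 hπ₂D hD2 with
      ⟨hC₁, hG₁⟩ | ⟨o, ho, s, s₂, hs, hs₂, hoor⟩
    · rcases untouched_or_carrier I hI hS hB hD he₀ (mv := (1, 0)) hW.hT₂ hD.disj₂ hGf₂ hlin₂ hpol₂ hr10 hZ10 hπ₁ h12 hπ₂D hD2 with
        ⟨hC₂, hG₂⟩ | ⟨o, ho, s, s₂, hs, hs₂, hoor⟩
      · exact (cross_touch I hI hD hπ₁.1 hπ₁.2 hC₁ hC₂ hG₁ hG₂).elim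
      · exact ⟨o, mem_union_right _ (mem_filter.1 ho).1, s, s₂, hs, hs₂, hoor⟩
    · exact ⟨o, mem_union_left _ (mem_filter.1 ho).1, s, s₂, hs, hs₂, hoor⟩
  have hoJ : o ∉ B.J₀ := by
    rcases mem_union.1 hoG with h | h
    · exact Finset.disjoint_left.1 hd₁ h
    · exact Finset.disjoint_left.1 hD.disj₂ h
  have hog₀ : g₀ ∉ ({o} : Finset (Fin m)) := by
    rw [mem_singleton]
    intro h
    rw [← h] at hoG
    rcases mem_union.1 hoG with h' | h'
    · exact hD.gate_nmem h'
    · exact ((hD.hun _ (vars_mem_privs I hD.mem_p (s := 2) (by decide))).2 g₀ h').1 hD.gate_vars.1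
  have hoO : ({o} : Finset (Fin m)) ⊆ B.G₁ ∪ B.G₂ := singleton_subset_iff.2 hoG
  have hold : ∀ o' ∈ ({o} : Finset (Fin m)), (∃ j ∈ B.J₀, I.vars o' 2 ∈ varSet I j) ∧ (∃ j ∈ B.J₀, I.vars o' 3 ∈ varSet I j) := by
    intro o' ho'
    rw [mem_singleton] at ho'
    subst ho'
    rcases hoor with ⟨h2, h3⟩ | ⟨h2, h3⟩
    · exact ⟨⟨π₂, hπ₂J, h2 ▸ vars_mem_varSet I π₂ s₂⟩, ⟨π₁, hπ₁J, h3 ▸ vars_mem_varSet I π₁ s⟩⟩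
    · exact ⟨⟨π₁, hπ₁J, h2 ▸ vars_mem_varSet I π₁ s⟩, ⟨π₂, hπ₂J, h3 ▸ vars_mem_varSet I π₂ s₂⟩⟩
  obtain ⟨Pv', hPv'T, hpriv', hcount'⟩ :=
    cross_budget_carriers I hB hD hoO (disjoint_singleton_left.2 hoJ) hog₀ hold
  -- no private edge survives the carrier
  have hoX : o ∈ ({o} : Finset (Fin m)) ∪ insert g₀ B.J₀ := mem_union_left _ (mem_singleton_self o)
  have hread₁ : I.vars π₁ s ∈ varSet I o := by
    rcases hoor with ⟨-, h3⟩ | ⟨h2, -⟩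
    · exact h3 ▸ vars_mem_varSet I o 3
    · exact h2 ▸ vars_mem_varSet I o 2
  have hread₂ : I.vars π₂ s₂ ∈ varSet I o := by
    rcases hoor with ⟨h2, -⟩ | ⟨-, h3⟩
    · exact h2 ▸ vars_mem_varSet I o 2
    · exact h3 ▸ vars_mem_varSet I o 3
  have hPv'0 : Pv' = ∅ := by
    refine eq_empty_of_forall_notMem fun j hj => ?_
    have hjE : PrivEdge I B j := ⟨hPv'T hj, fun j' hj' hne => hpriv' j hj j' (mem_union_right _ (mem_insert_of_mem hj')) hne⟩
    have hjo : o ≠ j := fun h => hoJ (h ▸ (mem_sdiff.1 (hPv'T hj)).1)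
    have hp := hpriv' j hj o hoX hjo
    rcases hD2 j (hmemD j hjE) with rfl | rfl
    · rcases hs with rfl | rfl
      · exact hp.1 hread₁
      · exact hp.2 hread₁
    · rcases hs₂ with rfl | rfl
      · exact hp.1 hread₂
      · exact hp.2 hread₂
  rw [hPv'0, card_empty, card_singleton, hN3] at hcount'
  omega

end Summit.PneNP.PneNP.Theorems.PstarCrossCaseU2Final
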